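import Summits.CriticalPhenomena.PercolationContinuityZ3.Theorems.TallClusterMassBound.Negative.FalseWithoutCriticality
import Summits.CriticalPhenomena.PercolationContinuityZ3.Theorems.PercLowPointHalfSpaceTallClusterMassBoundWallArmPartial
import Literature.Probability.Percolation.UniversalTightness
import Literature.Probability.Percolation.HalfSpaceFloorDilution
import Mathlib.Analysis.SpecialFunctions.Pow.Real

/-!
# `TallClusterMassBound` (stmt-CriticalPhenomena-0912), line `SketchIdeator4` —
# stub `stub_tightnessArithmetic`

Pure real-analysis glue (ARROW 1, arithmetic half). Inputs: the layer-cake bound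
`M(r) ≤ K · M(Λ_r) · π_s(r) · (1 + log(1/π_s(r)))` (`M(Λ_r) = typicalMax PcH (halfBox r)`,
`π_s(r) = armProb p_c r`), a typical-max bound `M(Λ_r) ≤ C r^s` with `s < 11/4`, and the
landed one-scale floor `π_s(r) ≥ 1/(588 r²)` (`armProb_criticalProbI_ge`).
Output: `MassBoundAt p_c (11/4)`.

Proof. With `ε = 11/4 - s > 0`: `0 < π_s(r) ≤ 1` gives `0 ≤ log(1/π_s(r)) ≤ log(588 r²)
= log 588 + 2 log r ≤ log 588 + 2 r^ε/ε` (`Real.log_le_rpow_div`), and `1 ≤ r^ε`, so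
`1 + log(1/π_s(r)) ≤ D r^ε` with `D = 1 + log 588 + 2/ε`. Replacing `K, C` by `max K 0`,
`max C 0` (all other factors are nonnegative) and `r^s · r^ε = r^{11/4}` gives the constant
`max K 0 · max C 0 · D`.
-/

noncomputable section

open MeasureTheory Finset Filter
open Literature.Probability.Percolation Literature.Probability.LatticeModels
open Summit.CriticalPhenomena.PercolationContinuityZ3.Theorems.TallClusterMassBound.Negative
open Summit.CriticalPhenomena.PercolationContinuityZ3.Theorems.TallClusterMassBound.ReplicaOverlap
  (armProb_criticalProbI_ge)

namespace Summit.CriticalPhenomena.PercolationContinuityZ3.Theorems.TallClusterMassBound.TightnessLine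

/-- The logarithmic factor is controlled by a small power: at `p_c(ℤ³)`, for `r ≥ 1` and
`ε > 0`, `0 ≤ log(1/π_s(r))` and `1 + log(1/π_s(r)) ≤ (1 + log 588 + 2/ε) r^ε`
(from `π_s(r) ≥ 1/(588 r²)` and `log r ≤ r^ε/ε`). [folklore] -/
theorem one_add_log_inv_armProb_le {r : ℕ} (hr : 1 ≤ r) {ε : ℝ} (hε : 0 < ε) :
    0 ≤ Real.log (1 / armProb (criticalProbI 3) r) ∧
      1 + Real.log (1 / armProb (criticalProbI 3) r) ≤
        (1 + Real.log 588 + 2 / ε) * (r : ℝ) ^ ε := by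
  have hr1 : (1 : ℝ) ≤ r := by exact_mod_cast hr
  have hr0 : (0 : ℝ) < r := by linarith
  have hπpos : 0 < armProb (criticalProbI 3) r := armProb_criticalProbI_pos r
  have hπle : armProb (criticalProbI 3) r ≤ 1 := armProb_le_one _ r
  have hπge : 1 / (588 * (r : ℝ) ^ 2) ≤ armProb (criticalProbI 3) r :=
    armProb_criticalProbI_ge hr
  have h588 : (0 : ℝ) < 588 * (r : ℝ) ^ 2 := by positivity
  have hlog0 : 0 ≤ Real.log (1 / armProb (criticalProbI 3) r) :=
    Real.log_nonneg ((one_le_div hπpos).2 hπle)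
  have hinv : 1 / armProb (criticalProbI 3) r ≤ 588 * (r : ℝ) ^ 2 :=
    (one_div_le hπpos h588).2 hπge
  have hlog1 :
      Real.log (1 / armProb (criticalProbI 3) r) ≤ Real.log 588 + 2 * Real.log r := by
    have h := Real.log_le_log (by positivity) hinv
    rw [Real.log_mul (by norm_num) (by positivity), Real.log_pow] at h
    exact_mod_cast h
  have hlogr : Real.log r ≤ (r : ℝ) ^ ε / ε := Real.log_le_rpow_div hr0.le hε
  have hrε : 1 ≤ (r : ℝ) ^ ε := Real.one_le_rpow hr1 hε.le
  have hl588 : 0 ≤ Real.log 588 := Real.log_nonneg (by norm_num)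
  refine ⟨hlog0, ?_⟩
  calc 1 + Real.log (1 / armProb (criticalProbI 3) r)
      ≤ 1 + (Real.log 588 + 2 * ((r : ℝ) ^ ε / ε)) := by linarith
    _ ≤ (1 + Real.log 588) * (r : ℝ) ^ ε + 2 / ε * (r : ℝ) ^ ε := by
        have h1 : (1 + Real.log 588) * 1 ≤ (1 + Real.log 588) * (r : ℝ) ^ ε :=
          mul_le_mul_of_nonneg_left hrε (by linarith)
        have h2 : 2 * ((r : ℝ) ^ ε / ε) = 2 / ε * (r : ℝ) ^ ε := by ring
        linarith
    _ = (1 + Real.log 588 + 2 / ε) * (r : ℝ) ^ ε := by ring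

/-- **STUB 1b (ARROW 1, arithmetic) — from the log bound and C⁺ to `MassBoundAt p_c (11/4)`.**
Inputs: the layer-cake bound `M(r) ≤ K · M(Λ_r) · π_s(r) · (1 + log(1/π_s(r)))` with
constant `K`, a typical-max bound `M(Λ_r) ≤ C r^s` with `s < 11/4`, and the landed floor
`π_s(r) ≥ 1/(588 r²)` (`armProb_criticalProbI_ge`), whence
`log(1/π_s(r)) ≤ log 588 + 2 log r` and `r^s (1 + log 588 + 2 log r) ≤ C_s r^{11/4}`
(`Real.log_le_rpow_div`); `K ≤ 0` / `C ≤ 0` are absorbed by `max K 0`, `max C 0`. [folklore] -/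
theorem stub_tightnessArithmetic :
    ∀ (K s C : ℝ), s < (11 : ℝ) / 4 →
      (∀ r : ℕ, 1 ≤ r →
        mass (criticalProbI 3) r ≤
          K * (typicalMax (floorDilutedPercolation 3 (criticalProbI 3) 1) (halfBox r) : ℝ) *
            armProb (criticalProbI 3) r * (1 + Real.log (1 / armProb (criticalProbI 3) r))) →
      (∀ r : ℕ, 1 ≤ r →
        (typicalMax (floorDilutedPercolation 3 (criticalProbI 3) 1) (halfBox r) : ℝ) ≤ C * (r : ℝ) ^ s) →
      MassBoundAt (criticalProbI 3) ((11 : ℝ) / 4) := by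
  intro K s C hs hmass hM
  obtain ⟨ε, hε, hεs⟩ : ∃ ε : ℝ, 0 < ε ∧ s + ε = (11 : ℝ) / 4 :=
    ⟨11 / 4 - s, by linarith, by ring⟩
  refine ⟨max K 0 * max C 0 * (1 + Real.log 588 + 2 / ε), fun r hr => ?_⟩
  have hmr := hmass r hr
  have hMr := hM r hr
  obtain ⟨hlog0, hL⟩ := one_add_log_inv_armProb_le hr hε
  have hr0 : (0 : ℝ) < r := by exact_mod_cast hr
  have hπpos : 0 < armProb (criticalProbI 3) r := armProb_criticalProbI_pos r
  have hL0 : 0 ≤ 1 + Real.log (1 / armProb (criticalProbI 3) r) := by linarith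
  have hrs : 0 ≤ (r : ℝ) ^ s := Real.rpow_nonneg hr0.le s
  have hMC : (typicalMax (floorDilutedPercolation 3 (criticalProbI 3) 1) (halfBox r) : ℝ) ≤
      max C 0 * (r : ℝ) ^ s :=
    hMr.trans (mul_le_mul_of_nonneg_right (le_max_left _ _) hrs)
  have hsplit : (r : ℝ) ^ ((11 : ℝ) / 4) = (r : ℝ) ^ s * (r : ℝ) ^ ε := by
    rw [← Real.rpow_add hr0, hεs]
  calc mass (criticalProbI 3) r
      ≤ K * (typicalMax (floorDilutedPercolation 3 (criticalProbI 3) 1) (halfBox r) : ℝ) *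
          armProb (criticalProbI 3) r * (1 + Real.log (1 / armProb (criticalProbI 3) r)) := hmr
    _ ≤ max K 0 * (typicalMax (floorDilutedPercolation 3 (criticalProbI 3) 1) (halfBox r) : ℝ) *
          armProb (criticalProbI 3) r * (1 + Real.log (1 / armProb (criticalProbI 3) r)) := by
        have h0 : 0 ≤
            (typicalMax (floorDilutedPercolation 3 (criticalProbI 3) 1) (halfBox r) : ℝ) *
              armProb (criticalProbI 3) r *
                (1 + Real.log (1 / armProb (criticalProbI 3) r)) := by
          positivity
        have h := mul_le_mul_of_nonneg_right (le_max_left K 0) h0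
        linarith [h]
    _ ≤ max K 0 * (max C 0 * (r : ℝ) ^ s) *
          armProb (criticalProbI 3) r * (1 + Real.log (1 / armProb (criticalProbI 3) r)) := by
        gcongr
    _ ≤ max K 0 * (max C 0 * (r : ℝ) ^ s) *
          armProb (criticalProbI 3) r * ((1 + Real.log 588 + 2 / ε) * (r : ℝ) ^ ε) := by
        gcongr
    _ = max K 0 * max C 0 * (1 + Real.log 588 + 2 / ε) * ((r : ℝ) ^ s * (r : ℝ) ^ ε) *
          armProb (criticalProbI 3) r := by ring
    _ = max K 0 * max C 0 * (1 + Real.log 588 + 2 / ε) * (r : ℝ) ^ ((11 : ℝ) / 4) *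
          armProb (criticalProbI 3) r := by rw [hsplit]

end Summit.CriticalPhenomena.PercolationContinuityZ3.Theorems.TallClusterMassBound.TightnessLine
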